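import Summits.CriticalPhenomena.PercolationContinuityZ3.Theorems.Transplant.PlanarSkeletonFrmQuasiDefs
import Summits.CriticalPhenomena.PercolationContinuityZ3.Theorems.Transplant.PlanarSkeletonFrmFromProx
import HarnessLib

/-!
# WAVE-Q row (c3): **THE PROXY PACKAGE ON THE QUASI-STEP CARRIER** — `PlanarSkeletonFrmQuasi.HasProxies Φ t D` (every vertex has, within graph distance `D`, a vertex
# of the same chart position that is a `t`-frame image), the proxy map `prox`, and PROXIES FROM ALIGNMENT (the radius from (κ″), no connectivity or step hypothesis)

builds on p205010 (kernel theorem, internal audit signed; external expert review pending) — nothing in this file uses p205010.  TWO definitions (`HasProxies`, a `Prop`,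
and the choice map `HasProxies.prox`; review-queued by D-0009), VERBATIM twins of «PlanarSkeletonFrmFromProxies» §1 (p3 gen 26) / «PlanarSkeletonFrmFromProx» §1 over
the (N3-b) carrier «PlanarSkeletonFrmQuasiDefs» (p507026); no node / statement / `@[conjecture]`; NOTHING about the quasi-step node, its name or wording is claimed.
Lane `prim-bschramm`, seat `prim-bschramm-stmt` gen 33 (port pen; row (c3) handed over BY NAME by the design owner p3 gen 29, bus 2026-08-27 #6066/#6072).  Helper file
(`--supports stmt-CriticalPhenomena-4575 --as helper`).
* §1 `HasProxies` (verbatim), `HasProxies.of_types_eq` (one type ⇒ radius `0`, `c′ = c`), `HasProxies.mono`, `HasProxies.of_aligned` (the distance-datum form, verbatim twin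
  of «SkelFrmFromProxHoldsAll» §2: compose the frame `β : s ↦ c` with a `t`-framed `u` at the value of `s`), and **`exists_hasProxies_of_aligned (Φ) (t) (hal : ∀ s ∈ Φ.types,
  ∃ α : G ≃g G, φ ∘ α = φ + (φ s − φ t)) : ∃ D, Φ.HasProxies t D`** — at ONE scale the aligned frame `α_s` itself supplies `u_s := α_s t` with `φ u_s = φ s` (no realiser
  walk, no `N`-divisibility bookkeeping as in «PlanarSkeletonFrmScaledCoarseMulti»), and the radius is the largest length, over the finitely many types, of a walk
  `u_s ⇝ s` supplied by (κ″) `cyl_reach` at the base vertex `s` (both ends lie in `cyl s ℓ₀`) — so NO connectivity hypothesis and no use of the quasi-steps;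
* §2 the proxy map `HasProxies.prox` with `prox_spec`, `φ_prox`, `mem_graphBall_prox`, `exists_frame_prox`, `oriφ_prox`, `prox_eq_self_of_zero` (verbatim twins; the carrier type
  `{Φ : PlanarSkeletonFrmQuasi G}` is spelled in every header — the twinned-type device of the U wave, M-12b — so the headers differ from the From twins');
* §3 regression through the forgetful map: `PlanarSkeletonFrmFrom.hasProxies_toFrmQuasi_iff` (`Iff.rfl`) and `HasProxies.toFrmQuasi`.
The junction-facing sentences of the From files (`mem_fatSeq`, `inputsAt`, `inputsAt_prox/proxR`, `zoneAt_prox/proxR`) read the Step-I / kit layers and are NOT ported here (they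
belong with the Q junction rows).
[cite: KozmaNitzan2024, §4 p. 15, pp. 19–21 ((21)–(25): the inputs at every vertex by transitivity)] [cite: MartineauTassion2017, §3.1–3.2] [cite: BenjaminiSchramm1996, Conj. 4; §2]
-/

noncomputable section

open scoped Classical

namespace Summit.CriticalPhenomena.PercolationContinuityZ3.Theorems.Transplant

open MeasureTheory Literature.Probability.Percolation Literature.Probability.LatticeModels SimpleGraph
open Literature.Barriers.CriticalPhenomena (graphBall mem_graphBall_self graphBall_mono)
open Skelφ (oriφ)

namespace PlanarSkeletonFrmQuasi

variable {V : Type} {G : SimpleGraph V} [G.LocallyFinite]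

/-! ## §1 The proxy package and proxies from alignment -/

/-- **PROXIES at radius `D` for the base vertex `t`** (quasi-step carrier): every vertex `c` has a vertex `c′` within graph distance `D`, at the SAME chart position, which is
the image of `t` under an automorphism translating the chart.  Verbatim the From shape («PlanarSkeletonFrmFromProxies»). [this work] -/
def HasProxies (Φ : PlanarSkeletonFrmQuasi G) (t : V) (D : ℕ) : Prop :=
  ∀ c : V, ∃ (c' : V) (α : G ≃g G), α t = c' ∧ (∀ w, Φ.φ (α w) = Φ.φ w + (Φ.φ c' - Φ.φ t)) ∧ Φ.φ c' = Φ.φ c ∧ c ∈ graphBall G c' D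

/-- **One type ⇒ proxies at radius `0`** (the proxy of `c` is `c` itself, framed from `t` by the field `frame`). [folklore] -/
theorem HasProxies.of_types_eq (Φ : PlanarSkeletonFrmQuasi G) {t : V} (h1 : Φ.types = {t}) : Φ.HasProxies t 0 := by
  intro c
  obtain ⟨s, hs, α, hαs, hφ⟩ := Φ.frame c
  rw [h1, Finset.mem_singleton] at hs
  subst hs
  exact ⟨c, α, hαs, hφ, rfl, mem_graphBall_self G c 0⟩

/-- Proxies at radius `D` are proxies at every larger radius. [folklore] -/
theorem HasProxies.mono {Φ : PlanarSkeletonFrmQuasi G} {t : V} {D D' : ℕ} (h : Φ.HasProxies t D) (hD : D ≤ D') : Φ.HasProxies t D' := by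
  intro c
  obtain ⟨c', α, hαt, hφ, hcell, hball⟩ := h c
  exact ⟨c', α, hαt, hφ, hcell, graphBall_mono G c' hD hball⟩

/-- **CHART-ALIGNED TYPES WITH A DISTANCE DATUM GIVE PROXIES**: if every base type `s ∈ Φ.types` has, within graph distance `D`, a vertex `u` framed from `t` with the SAME chart
value `φ u = φ s`, then EVERY vertex has a proxy of type `t` at radius `D` — compose the frame `β : s ↦ c` of the vertex `c` with `γ : t ↦ u`; automorphisms preserve graph
balls.  Verbatim twin of «SkelFrmFromProxHoldsAll» `HasProxies.of_aligned`. [cite: KozmaNitzan2024, §4 pp. 19–21] -/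
theorem HasProxies.of_aligned (Φ : PlanarSkeletonFrmQuasi G) {t : V} {D : ℕ}
    (hal : ∀ s ∈ Φ.types, ∃ (u : V) (γ : G ≃g G), γ t = u ∧ (∀ w, Φ.φ (γ w) = Φ.φ w + (Φ.φ u - Φ.φ t)) ∧ Φ.φ u = Φ.φ s ∧ s ∈ graphBall G u D) :
    Φ.HasProxies t D := by
  intro c
  obtain ⟨s, hs, β, hβs, hβφ⟩ := Φ.frame c
  obtain ⟨u, γ, hγt, hγφ, hus, hsu⟩ := hal s hs
  refine ⟨β u, γ.trans β, ?_, ?_, ?_, ?_⟩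
  · show β (γ t) = β u
    rw [hγt]
  · intro w
    show Φ.φ (β (γ w)) = Φ.φ w + (Φ.φ (β u) - Φ.φ t)
    rw [hβφ, hγφ, hβφ]
    abel
  · rw [hβφ, hus]; abel
  · have h := PlanarSkeletonFrm.mem_graphBall_map β hsu
    rwa [hβs] at h

/-- **PROXIES FROM ALIGNMENT, no distance datum, no connectivity hypothesis**: if every base type `s` is aligned with `t` by SOME chart-translating automorphism `α_s`
(`φ ∘ α_s = φ + (φ s − φ t)`), then `Φ.HasProxies t D` for some `D`.  At one scale `u_s := α_s t` already has `φ u_s = φ s` and is framed from `t`; `u_s` and `s` both lie in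
the cylinder `cyl s ℓ₀`, so (κ″) joins them (inside `cyl s (ℓ₀ + W)`, hence in `G`); `D :=` the largest such walk length over the finitely many types. [cite: KozmaNitzan2024, §4 p. 15, pp. 19–21]
[cite: MartineauTassion2017, §3.2] -/
theorem exists_hasProxies_of_aligned (Φ : PlanarSkeletonFrmQuasi G) (t : V)
    (hal : ∀ s ∈ Φ.types, ∃ α : G ≃g G, ∀ w, Φ.φ (α w) = Φ.φ w + (Φ.φ s - Φ.φ t)) : ∃ D : ℕ, Φ.HasProxies t D := by
  -- for every vertex `s`: a `t`-framed `u` at the value of `s` and a walk length, meaningful when `s` is a type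
  have hreal : ∀ s : V, ∃ (u : V) (n : ℕ),
      (s ∈ Φ.types → (∃ γ : G ≃g G, γ t = u ∧ ∀ w, Φ.φ (γ w) = Φ.φ w + (Φ.φ u - Φ.φ t)) ∧ Φ.φ u = Φ.φ s) ∧ s ∈ graphBall G u n := by
    intro s
    by_cases hs : s ∈ Φ.types
    · obtain ⟨α, hα⟩ := hal s hs
      have hφu : Φ.φ (α t) = Φ.φ s := by rw [hα t]; abel
      have h0s : Φ.φ s - Φ.φ s ∈ box 2 Φ.ℓ₀ := by rw [sub_self]; exact zero_mem_box 2 _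
      have h0u : Φ.φ (α t) - Φ.φ s ∈ box 2 Φ.ℓ₀ := by rw [hφu, sub_self]; exact zero_mem_box 2 _
      obtain ⟨hu', hs', hr⟩ := Φ.cyl_reach s hs Φ.ℓ₀ le_rfl (α t) s h0u h0s
      obtain ⟨p⟩ := hr.map (Embedding.induce _).toHom
      refine ⟨α t, p.length, fun _ => ⟨⟨α, rfl, fun w => by rw [hα w, hφu]⟩, hφu⟩, ⟨p, le_rfl⟩⟩
    · exact ⟨s, 0, fun h => absurd h hs, mem_graphBall_self G s 0⟩
  choose u n hu hun using hreal
  refine ⟨Φ.types.sup n, HasProxies.of_aligned Φ fun s hs => ?_⟩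
  obtain ⟨⟨γ, hγt, hγφ⟩, hus⟩ := hu s hs
  exact ⟨u s, γ, hγt, hγφ, hus, graphBall_mono G (u s) (Finset.le_sup hs) (hun s)⟩

/-! ## §2 The proxy map -/

/-- **The proxy map**: a proxy `prox c` chosen once for every centre `c` from `HasProxies` (same chart position, graph distance `≤ D`, a `t`-frame image). [folklore] -/
def HasProxies.prox {Φ : PlanarSkeletonFrmQuasi G} {t : V} {D : ℕ} (_h : Φ.HasProxies t D) (c : V) : V := if h' : Φ.HasProxies t D then Classical.choose (h' c) else c

/-- The defining property of the chosen proxy. [folklore] -/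
theorem HasProxies.prox_spec {Φ : PlanarSkeletonFrmQuasi G} {t : V} {D : ℕ} (h : Φ.HasProxies t D) (c : V) :
    ∃ α : G ≃g G, α t = h.prox c ∧ (∀ w, Φ.φ (α w) = Φ.φ w + (Φ.φ (h.prox c) - Φ.φ t)) ∧ Φ.φ (h.prox c) = Φ.φ c ∧ c ∈ graphBall G (h.prox c) D := by
  have hs := Classical.choose_spec (h c)
  simp only [HasProxies.prox, dif_pos h]
  exact hs

/-- The proxy has the centre's chart position. [folklore] -/
theorem HasProxies.φ_prox {Φ : PlanarSkeletonFrmQuasi G} {t : V} {D : ℕ} (h : Φ.HasProxies t D) (c : V) : Φ.φ (h.prox c) = Φ.φ c := by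
  obtain ⟨-, -, -, hcell, -⟩ := h.prox_spec c
  exact hcell

/-- The centre lies within graph distance `D` of its proxy. [folklore] -/
theorem HasProxies.mem_graphBall_prox {Φ : PlanarSkeletonFrmQuasi G} {t : V} {D : ℕ} (h : Φ.HasProxies t D) (c : V) : c ∈ graphBall G (h.prox c) D := by
  obtain ⟨-, -, -, -, hball⟩ := h.prox_spec c
  exact hball

/-- The proxy is a `t`-frame image. [folklore] -/
theorem HasProxies.exists_frame_prox {Φ : PlanarSkeletonFrmQuasi G} {t : V} {D : ℕ} (h : Φ.HasProxies t D) (c : V) :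
    ∃ α : G ≃g G, α t = h.prox c ∧ ∀ w, Φ.φ (α w) = Φ.φ w + (Φ.φ (h.prox c) - Φ.φ t) := by
  obtain ⟨α, hαt, hφ, -, -⟩ := h.prox_spec c
  exact ⟨α, hαt, hφ⟩

/-- The oriented chart reads the same value at the centre and at its proxy. [folklore] -/
theorem HasProxies.oriφ_prox {Φ : PlanarSkeletonFrmQuasi G} {t : V} {D : ℕ} (h : Φ.HasProxies t D) (b : Bool) (c : V) : oriφ Φ.φ b (h.prox c) = oriφ Φ.φ b c := by
  cases b
  · funext i; simp only [Skelφ.oriφ_false, Skelφ.trφ_apply, h.φ_prox c]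
  · simp only [Skelφ.oriφ_true, h.φ_prox c]

/-- **One type is the instance `prox = id`**: at radius `0` the proxy is the centre itself. [folklore] -/
theorem HasProxies.prox_eq_self_of_zero {Φ : PlanarSkeletonFrmQuasi G} {t : V} (h : Φ.HasProxies t 0) (c : V) : h.prox c = c := by
  obtain ⟨w, hw⟩ := h.mem_graphBall_prox c
  have h0 : w.length = 0 := Nat.le_zero.1 hw
  exact ((SimpleGraph.Walk.eq_of_length_eq_zero h0)).symm ▸ rfl

end PlanarSkeletonFrmQuasi

/-! ## §3 Regression through the forgetful map -/

namespace PlanarSkeletonFrmFrom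

variable {V : Type} {G : SimpleGraph V} [G.LocallyFinite] (Φ : PlanarSkeletonFrmFrom G)

/-- The proxy package of `Φ.toFrmQuasi` is the proxy package of `Φ` (same chart, same types). [folklore] -/
theorem hasProxies_toFrmQuasi_iff (t : V) (D : ℕ) : Φ.toFrmQuasi.HasProxies t D ↔ Φ.HasProxies t D := Iff.rfl

/-- From-proxies are Quasi-proxies of the forgetful image. [folklore] -/
theorem HasProxies.toFrmQuasi {t : V} {D : ℕ} (h : Φ.HasProxies t D) : Φ.toFrmQuasi.HasProxies t D := h

end PlanarSkeletonFrmFrom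

end Summit.CriticalPhenomena.PercolationContinuityZ3.Theorems.Transplant

end
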